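import Mathlib
import Summits.ResolutionOfSingularities.ResolutionOfSingularities.Theorems.RadicialJungCleanModelsCleanLU3Defectless
import HarnessLib

/-!
# Route `RadicialJung`, crux `CleanModels` (stmt-15917), line `Sketch` rev 35, stub 7 `stub_cleanModelsDimGEFour`: clean local
# uniformization from a MONOMIAL PRESENTATION of the best-approximation remainder — the exact joint at which the defectless and
# Abhyankar halves consume resolution input, in every dimension

Explicit-unit seat `decomp-res-hand-2` g2 (structural hand, stubs 5–7).  OURS; nothing here proves resolution in characteristic `p`.

The dimension-`d` defectless half ✓ `cleanLU_dim_of_isMin_pthPowerApprox` (`…CleanLUDimDefectless.lean`) uses its embedded-resolution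
hypothesis `hEmb_N` for ONE purpose: to present the remainder `g₀ − f₀^p` of a best `p`-th-power approximation as a unit times a LAURENT
MONOMIAL in a regular system of parameters of the local ring, at the centre of the valuation, of some finitely generated model `A' ⊇ A` inside
`O` (via the bottleneck ✓ `exists_localRing_monomial_of_embeddedResolution_gen`).  This file isolates the joint, DEF-FREE:

* `cleanLUConcl_of_isMin_pthPowerApprox_of_laurentMonomial` — given such a presentation on a model `A'` (any dimension, any valuation), the
  conclusion of the dim-`d` local input (`hBest_d` / `hAbh_d` of `…CleanLUDimCases`, = the registered shape of `stub_cleanLU3` with `3 ↦ d`)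
  holds AT `A'`: read-off ✓ `cleanRegAt_of_isMin_pthPowerApprox_zpow` + ✓ `forms_of_looseCleanForm`;
* `cleanLUConcl_of_isMin_pthPowerApprox_of_monomial_num_den` — the same from SEPARATE monomial presentations (natural exponents) of a
  numerator and a denominator of the remainder, `g₀ − f₀^p = x / y` — the shape in which valuation-theoretic local uniformization theorems
  deliver finitely many prescribed elements (e.g. Knaf–Kuhlmann 2005 Thm. 1.1 at Abhyankar places with separably generated residue field,
  whose monomiality clause the tree's `KnafKuhlmann2005_Thm11` does NOT vendor; Cossart–Piltant / CJS in dimension three).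

Consequence for the census of stub 7 (`…CleanModelsDimGEFourOfEmbRes.lean`): the inputs `hBest_d`, `hAbh_d` cost exactly «a finitely generated
model `A' ⊇ A` in `O`, regular at the centre of `v`, on which the remainder (or a numerator and a denominator of it) is a monomial» — LOCAL
UNIFORMIZATION STRENGTH for one hypersurface germ along one zero-dimensional valuation, not embedded-resolution strength; `hEmb_{d−1}` is one
sufficient source (the only one in the tree for `d ≥ 4`).
-/

noncomputable section

set_option linter.dupNamespace false -- mandated namespace of this single-conjunct summit

open IsLocalRing AlgebraicGeometry CategoryTheory
open Literature.AlgebraicGeometry.Resolution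

namespace Summit.ResolutionOfSingularities.ResolutionOfSingularities.Theorems.RadicialJung.CleanModels

/-- **Clean local uniformization from a Laurent-monomial presentation of the best-approximation remainder.**  Let `O` be a valuation ring of
`K ⊇ k`, `A ⊆ A' ⊆ O` finitely generated `k`-subalgebras with `(locAtCentre A'.toSubring O) = (A')_{𝔪_O ∩ A'}` (`locAtCentre A' O`) a regular local ring of dimension
`d` with regular system of parameters `z`, `f₀^p` a best `p`-th-power approximation of `g₀` for `v`, and `g₀ − f₀^p = u · ∏ zᵢ^{aᵢ}` with
`u ∈ (locAtCentre A'.toSubring O)ˣ`, `aᵢ ∈ ℤ`.  Then the conclusion of the dim-`d` local input of the line (a finitely generated `A ⊆ A' ⊆ O`, regular at the centre,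
carrying a loosely clean non-trivial representative of the `K^p`-line of `g₀`) holds, witnessed by `A'` itself.  Any dimension, any valuation.
[folklore] -/
theorem cleanLUConcl_of_isMin_pthPowerApprox_of_laurentMonomial
    (p : ℕ) (hp : p.Prime) (k : Type) [Field k] [CharP k p] (K : Type) [Field K] [Algebra k K]
    (O : ValuationSubring K) (A : Subalgebra k K) (g₀ f₀ : K)
    (hmin : ∀ f : K, O.valuation (g₀ - f₀ ^ p) ≤ O.valuation (g₀ - f ^ p))
    (A' : Subalgebra k K) (hA'O : A'.toSubring ≤ O.toSubring) (hAA' : A ≤ A') (hA'fg : A'.FG)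
    (hreg : IsRegularLocalRing (locAtCentre A'.toSubring O))
    {d : ℕ} (z : Fin d → ↥(locAtCentre A'.toSubring O))
    (hspan : Ideal.span (Set.range z) = maximalIdeal ↥(locAtCentre A'.toSubring O))
    (hdim : ringKrullDim ↥(locAtCentre A'.toSubring O) = d)
    (a : Fin d → ℤ) (u : ↥(locAtCentre A'.toSubring O)) (hu : IsUnit u)
    (hG : g₀ - f₀ ^ p = (u : K) * ∏ i, ((z i : ↥(locAtCentre A'.toSubring O)) : K) ^ (a i)) :
    ∃ (A' : Subalgebra k K), A'.toSubring ≤ O.toSubring ∧ A ≤ A' ∧ A'.FG ∧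
      ∃ (_ : IsRegularLocalRing (locAtCentre A'.toSubring O)) (c : Fin p → K),
        (∃ j : Fin p, (j : ℕ) ≠ 0 ∧ c j ≠ 0) ∧
        ((∃ (d m : ℕ) (hmd : m ≤ d) (t : Fin d → ↥(locAtCentre A'.toSubring O)) (a : Fin m → ℕ)
            (u : ↥(locAtCentre A'.toSubring O)), IsUnit u ∧
            Ideal.span (Set.range t) = IsLocalRing.maximalIdeal ↥(locAtCentre A'.toSubring O) ∧
            ringKrullDim ↥(locAtCentre A'.toSubring O) = (d : WithBot ℕ∞) ∧ 0 < m ∧ (∀ i, ¬ p ∣ a i) ∧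
            (∑ j : Fin p, c j ^ p * g₀ ^ (j : ℕ)) =
              (u : K) * ∏ i : Fin m, ((t (Fin.castLE hmd i) : ↥(locAtCentre A'.toSubring O)) : K) ^ (a i)) ∨
          (∃ u : ↥(locAtCentre A'.toSubring O), IsUnit u ∧ (∑ j : Fin p, c j ^ p * g₀ ^ (j : ℕ)) = (u : K) ∧
            ∀ c' : ↥(locAtCentre A'.toSubring O), u - c' ^ p ∉ IsLocalRing.maximalIdeal ↥(locAtCentre A'.toSubring O)) ∨
          (∃ s c' : ↥(locAtCentre A'.toSubring O), (∑ j : Fin p, c j ^ p * g₀ ^ (j : ℕ)) = (s : K) ∧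
            s - c' ^ p ∈ IsLocalRing.maximalIdeal ↥(locAtCentre A'.toSubring O) ∧
            s - c' ^ p ∉ IsLocalRing.maximalIdeal ↥(locAtCentre A'.toSubring O) ^ 2)) := by
  classical
  haveI : Fact p.Prime := ⟨hp⟩
  haveI : CharP K p := charP_of_injective_algebraMap (algebraMap k K).injective p
  haveI := hreg
  have hR₂O : (locAtCentre A'.toSubring O) ≤ O.toSubring := locAtCentre_le hA'O
  have hdom₂ : ∀ w : (locAtCentre A'.toSubring O), w ∈ maximalIdeal (locAtCentre A'.toSubring O) → O.valuation (w : K) < 1 := fun w hw =>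
    (mem_maximalIdeal_locAtCentre_iff hA'O w).mp hw
  -- `z` is a regular system of parameters of `(locAtCentre A'.toSubring O)`, hence consists of non-zero elements
  have hd' : (maximalIdeal (locAtCentre A'.toSubring O)).spanFinrank = d := by
    have h := IsRegularLocalRing.spanFinrank_maximalIdeal (R := (locAtCentre A'.toSubring O))
    rw [hdim] at h
    exact_mod_cast h
  have hzr : IsRsopPart z := isRsopPart_comp_of_rsop hd' z hspan id Function.injective_id
  have hz0 : ∀ i, (z i : K) ≠ 0 := fun i h => hzr.ne_zero i (Subtype.ext h)
  -- READ OFF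
  have hclean : CleanRegAt p (locAtCentre A'.toSubring O).subtype g₀ :=
    cleanRegAt_of_isMin_pthPowerApprox_zpow O (locAtCentre A'.toSubring O) hR₂O hdom₂ g₀ f₀ hmin z hspan hdim hz0 a u hu hG
  refine ⟨A', hA'O, hAA', hA'fg, ?_⟩
  obtain ⟨hregR, c, hc, hform⟩ := hclean
  exact ⟨hregR, c, hc, forms_of_looseCleanForm hform⟩

/-- **Clean local uniformization from monomial presentations of a numerator and a denominator of the best-approximation remainder.**  As
`cleanLUConcl_of_isMin_pthPowerApprox_of_laurentMonomial`, with the hypothesis in the shape delivered by local uniformization theorems for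
finitely many prescribed elements: `g₀ − f₀^p = x / y` with `x = u₁ ∏ zᵢ^{βᵢ}`, `y = u₂ ∏ zᵢ^{γᵢ}` (`u₁, u₂` units, `βᵢ, γᵢ ∈ ℕ`) in the
regular local ring `(A')_{𝔪_O ∩ A'}`.  [folklore] -/
theorem cleanLUConcl_of_isMin_pthPowerApprox_of_monomial_num_den
    (p : ℕ) (hp : p.Prime) (k : Type) [Field k] [CharP k p] (K : Type) [Field K] [Algebra k K]
    (O : ValuationSubring K) (A : Subalgebra k K) (g₀ f₀ : K)
    (hmin : ∀ f : K, O.valuation (g₀ - f₀ ^ p) ≤ O.valuation (g₀ - f ^ p))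
    (A' : Subalgebra k K) (hA'O : A'.toSubring ≤ O.toSubring) (hAA' : A ≤ A') (hA'fg : A'.FG)
    (hreg : IsRegularLocalRing (locAtCentre A'.toSubring O))
    {d : ℕ} (z : Fin d → ↥(locAtCentre A'.toSubring O))
    (hspan : Ideal.span (Set.range z) = maximalIdeal ↥(locAtCentre A'.toSubring O))
    (hdim : ringKrullDim ↥(locAtCentre A'.toSubring O) = d)
    (x y : ↥(locAtCentre A'.toSubring O)) (hxy : g₀ - f₀ ^ p = (x : K) / (y : K))
    (β γ : Fin d → ℕ) (u₁ u₂ : ↥(locAtCentre A'.toSubring O)) (hu₁ : IsUnit u₁) (hu₂ : IsUnit u₂)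
    (hx : x = u₁ * ∏ i, z i ^ β i) (hy : y = u₂ * ∏ i, z i ^ γ i) :
    ∃ (A' : Subalgebra k K), A'.toSubring ≤ O.toSubring ∧ A ≤ A' ∧ A'.FG ∧
      ∃ (_ : IsRegularLocalRing (locAtCentre A'.toSubring O)) (c : Fin p → K),
        (∃ j : Fin p, (j : ℕ) ≠ 0 ∧ c j ≠ 0) ∧
        ((∃ (d m : ℕ) (hmd : m ≤ d) (t : Fin d → ↥(locAtCentre A'.toSubring O)) (a : Fin m → ℕ)
            (u : ↥(locAtCentre A'.toSubring O)), IsUnit u ∧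
            Ideal.span (Set.range t) = IsLocalRing.maximalIdeal ↥(locAtCentre A'.toSubring O) ∧
            ringKrullDim ↥(locAtCentre A'.toSubring O) = (d : WithBot ℕ∞) ∧ 0 < m ∧ (∀ i, ¬ p ∣ a i) ∧
            (∑ j : Fin p, c j ^ p * g₀ ^ (j : ℕ)) =
              (u : K) * ∏ i : Fin m, ((t (Fin.castLE hmd i) : ↥(locAtCentre A'.toSubring O)) : K) ^ (a i)) ∨
          (∃ u : ↥(locAtCentre A'.toSubring O), IsUnit u ∧ (∑ j : Fin p, c j ^ p * g₀ ^ (j : ℕ)) = (u : K) ∧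
            ∀ c' : ↥(locAtCentre A'.toSubring O), u - c' ^ p ∉ IsLocalRing.maximalIdeal ↥(locAtCentre A'.toSubring O)) ∨
          (∃ s c' : ↥(locAtCentre A'.toSubring O), (∑ j : Fin p, c j ^ p * g₀ ^ (j : ℕ)) = (s : K) ∧
            s - c' ^ p ∈ IsLocalRing.maximalIdeal ↥(locAtCentre A'.toSubring O) ∧
            s - c' ^ p ∉ IsLocalRing.maximalIdeal ↥(locAtCentre A'.toSubring O) ^ 2)) := by
  classical
  haveI := hreg
  -- `z` consists of non-zero elements
  have hd' : (maximalIdeal (locAtCentre A'.toSubring O)).spanFinrank = d := by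
    have h := IsRegularLocalRing.spanFinrank_maximalIdeal (R := (locAtCentre A'.toSubring O))
    rw [hdim] at h
    exact_mod_cast h
  have hzr : IsRsopPart z := isRsopPart_comp_of_rsop hd' z hspan id Function.injective_id
  have hz0 : ∀ i, (z i : K) ≠ 0 := fun i h => hzr.ne_zero i (Subtype.ext h)
  -- the unit `u₂` is non-zero in `K`
  obtain ⟨w₂, hw₂⟩ := hu₂
  have hu₂0 : ((u₂ : (locAtCentre A'.toSubring O)) : K) ≠ 0 := fun h => by
    have h1 : ((w₂ : (locAtCentre A'.toSubring O)) : K) * (((w₂⁻¹ : (locAtCentre A'.toSubring O)ˣ) : (locAtCentre A'.toSubring O)) : K) = 1 := by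
      rw [← Subring.coe_mul, ← Units.val_mul, mul_inv_cancel, Units.val_one, Subring.coe_one]
    rw [hw₂, h, zero_mul] at h1
    exact zero_ne_one h1
  -- `g₀ - f₀^p` is a unit times a Laurent monomial
  let u' : (locAtCentre A'.toSubring O) := u₁ * ((w₂⁻¹ : (locAtCentre A'.toSubring O)ˣ) : (locAtCentre A'.toSubring O))
  have hu' : IsUnit u' := hu₁.mul (Units.isUnit _)
  let a : Fin d → ℤ := fun i => (β i : ℤ) - (γ i : ℤ)
  have hxK : ((x : (locAtCentre A'.toSubring O)) : K) = ((u₁ : (locAtCentre A'.toSubring O)) : K) * ∏ i, (z i : K) ^ β i := by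
    have := congrArg (fun w : (locAtCentre A'.toSubring O) => (w : K)) hx
    simpa using this
  have hyK : ((y : (locAtCentre A'.toSubring O)) : K) = ((u₂ : (locAtCentre A'.toSubring O)) : K) * ∏ i, (z i : K) ^ γ i := by
    have := congrArg (fun w : (locAtCentre A'.toSubring O) => (w : K)) hy
    simpa using this
  have hinv : ((((w₂⁻¹ : (locAtCentre A'.toSubring O)ˣ) : (locAtCentre A'.toSubring O))) : K) = (((u₂ : (locAtCentre A'.toSubring O)) : K))⁻¹ := by
    refine (eq_inv_of_mul_eq_one_right ?_)
    rw [← hw₂, ← Subring.coe_mul, ← Units.val_mul, mul_inv_cancel, Units.val_one, Subring.coe_one]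
  have hu'K : (u' : K) = ((u₁ : (locAtCentre A'.toSubring O)) : K) * (((u₂ : (locAtCentre A'.toSubring O)) : K))⁻¹ := by
    change (((u₁ * ((w₂⁻¹ : (locAtCentre A'.toSubring O)ˣ) : (locAtCentre A'.toSubring O)) : (locAtCentre A'.toSubring O))) : K) = _
    rw [Subring.coe_mul, hinv]
  have hG : g₀ - f₀ ^ p = (u' : K) * ∏ i, (z i : K) ^ (a i) := by
    have hprod : (∏ i, (z i : K) ^ (a i)) = (∏ i, (z i : K) ^ β i) / ∏ i, (z i : K) ^ γ i := by
      rw [← Finset.prod_div_distrib]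
      refine Finset.prod_congr rfl fun i _ => ?_
      rw [zpow_sub₀ (hz0 i), zpow_natCast, zpow_natCast]
    rw [hxy, hxK, hyK, hu'K, hprod, mul_div_mul_comm, div_eq_mul_inv]
  exact cleanLUConcl_of_isMin_pthPowerApprox_of_laurentMonomial p hp k K O A g₀ f₀ hmin A' hA'O hAA' hA'fg hreg z hspan hdim
    a u' hu' hG

end Summit.ResolutionOfSingularities.ResolutionOfSingularities.Theorems.RadicialJung.CleanModels

end
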